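import Mathlib.Analysis.SpecialFunctions.Exp
import Mathlib.Analysis.Complex.ExponentialBounds
import Mathlib.Analysis.Real.Pi.Bounds
import HarnessLib

/-!
# K2R `RealisedQuasiStaticCellLaw`, line `floquet-bloch`, stub `stub_lowSectorWeakNear`: the GLOBAL scalar bookkeeping of the
# W-near road at the replayed cell word (helper; `--supports stmt-AnomalousDissipation-20446`)

Summits-side helper file (pure real arithmetic; no definitions, no named facts). With the closed forms (design note §10)
`MU = A(A₁ + A₂(1 − 10a/n))`, `ΣY = A(2A₁ + (160/21)A₂)`, `A₁ = 4π²·3720·M/n²`, `A₂ = 7M/(π²n²ν²)`, `A = ‖k‖² ∈ [1,3]`,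
`a = ‖k‖ ≤ δnν/10⁴`, the regime `M ≥ 400`, `ν ≤ 10⁻³`, `10⁵(M+1)/δ ≤ nν` and the choice `x = λP′ = (1 − δ/50)·MU`:
`near_global` returns the smallness of `MU` and `ΣY`, the END budget `x + x² + S² ≤ MU` for every `0 ≤ S ≤ 2ΣY`, the bounds
`λ ≤ ν`, `a²/(10⁴n²ν) ≤ λ`, `x ≤ 1/100`, the RATE comparison with the crux target `8π²(1 + (1−δ)c_W/ν²)ν/n²` and the prefactor
bound `(2·10⁵/δ)e^{2(1−δ/4)x} ≤ (10⁵(M+1)/δ)/ν`.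
-/

set_option linter.dupNamespace false

noncomputable section

namespace Summit.AnomalousDissipation.AnomalousDissipation.Theorems.SolenoidalFractalHomogenisation.RealisedQuasiStaticCellLaw

open Real

/-- **Global scalar bookkeeping of the W-near road at the cell.** -/
theorem near_global {A a M ν n δ cz : ℝ} (hA1 : 1 ≤ A) (hA3 : A ≤ 3) (hAa : A = a ^ 2) (ha0 : 0 ≤ a)
    (han : 10000 * a ≤ δ * (n * ν)) (hδ : 0 < δ) (hδ1 : δ ≤ 1) (hν : 0 < ν) (hν1 : ν ≤ 1 / 1000)
    (hM : 400 ≤ M) (hn : 0 < n) (hKn : 100000 * (M + 1) / δ ≤ n * ν) (hcz : cz = 7 / (4960 * π ^ 4)) :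
    let A₁ := 4 * π ^ 2 * 3720 * M / n ^ 2
    let A₂ := 7 * M / (π ^ 2 * n ^ 2 * ν ^ 2)
    let MU := A * (A₁ + A₂ * (1 - 10 * a / n))
    let SY := A * (2 * A₁ + 160 / 21 * A₂)
    let x := (1 - δ / 50) * MU
    0 ≤ MU ∧ MU ≤ δ / 60000 ∧ 0 ≤ SY ∧ SY ≤ 1 / 50 ∧ 0 ≤ x ∧ x ≤ 1 / 100 ∧
      (∀ S : ℝ, 0 ≤ S → S ≤ 2 * SY → x + x ^ 2 + S ^ 2 ≤ MU) ∧
      x * ν / (M * 3720) ≤ ν ∧ a ^ 2 / (10000 * (n ^ 2 * ν)) ≤ x * ν / (M * 3720) ∧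
      8 * π ^ 2 * (1 + (1 - δ) * ((1 - 4 * (1 / 2 : ℝ) / 3) * cz) / ν ^ 2) * ν / n ^ 2 ≤
        2 * (1 - 2 * (δ / 8)) * (x * ν / (M * 3720)) ∧
      200000 / δ * Real.exp (2 * (1 - 2 * (δ / 8)) * (x * ν / (M * 3720)) * (M * 3720 / ν)) ≤
        100000 * (M + 1) / δ / ν := by
  intro A₁ A₂ MU SY x
  have hπ := Real.pi_gt_three
  have hπ4 := Real.pi_lt_four
  have hM0 : 0 < M := by linarith
  have hnν : 0 < n * ν := mul_pos hn hν
  have hπ2 : 9 ≤ π ^ 2 := by nlinarith only [hπ]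
  have hπ16 : π ^ 2 ≤ 16 := by nlinarith only [hπ, hπ4]
  have hπd2 := Real.pi_lt_d2
  have hπ10 : π ^ 2 ≤ 10 := by nlinarith only [hπ, hπd2]
  -- the regime: `nν` is large
  have hK : 100000 * (M + 1) ≤ δ * (n * ν) := by
    have h := hKn; rw [div_le_iff₀ hδ] at h; linarith only [h]
  have hnν1 : 40000000 ≤ n * ν := by
    have : δ * (n * ν) ≤ n * ν := by nlinarith only [hδ1, hnν]
    linarith only [hK, this, hM]
  -- `a/n ≤ 10⁻⁷`
  have han' : 10000000 * a ≤ δ * n := by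
    have h2 := mul_le_mul_of_nonneg_left hν1 (by positivity : 0 ≤ δ * n)
    have h1 : δ * (n * ν) = δ * n * ν := by ring
    rw [h1] at han
    linarith only [han, h2]
  have hA0 : 0 < A := by linarith
  -- sizes of `A₁`, `A₂`
  have hA1pos : 0 < A₁ := by positivity
  have hA2pos : 0 < A₂ := by positivity
  have hA1le : A₁ * (n * ν) ^ 2 ≤ 150000 * M := by
    have e : A₁ * (n * ν) ^ 2 = 4 * π ^ 2 * 3720 * M * ν ^ 2 := by
      simp only [A₁]; field_simp
    rw [e]
    have hν2 : ν ^ 2 ≤ 1 := by nlinarith only [hν, hν1]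
    have := mul_le_mul hπ10 hν2 (by positivity) (by norm_num)
    nlinarith only [this, hM0]
  have hA2le : A₂ * (n * ν) ^ 2 ≤ M := by
    have e : A₂ * (n * ν) ^ 2 = 7 * M / π ^ 2 := by
      simp only [A₂]; field_simp
    rw [e, div_le_iff₀ (by positivity)]
    nlinarith only [hπ2, hM0]
  -- `A₂ ≥ 4 A₁` (small `ν`)
  have hA21 : 4 * A₁ ≤ A₂ := by
    simp only [A₁, A₂]
    rw [show 4 * (4 * π ^ 2 * 3720 * M / n ^ 2) = (16 * π ^ 2 * 3720 * M) / n ^ 2 by ring,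
      div_le_div_iff₀ (by positivity) (by positivity)]
    have hν2 : ν ^ 2 ≤ 1 / 1000000 := by nlinarith only [hν, hν1]
    -- 16π²·3720 M · π² n² ν² ≤ 7 M n²
    have h1 : π ^ 2 * π ^ 2 * ν ^ 2 ≤ 100 / 1000000 := by
      have := mul_le_mul (mul_le_mul hπ10 hπ10 (by positivity) (by norm_num)) hν2 (by positivity) (by norm_num)
      linarith only [this]
    have h2 : 0 < M * n ^ 2 := by positivity
    nlinarith only [h1, h2]
  -- MU and SY are small
  have han'' : 10 * a / n ≤ δ / 1000000 := by
    rw [div_le_iff₀ hn]; linarith only [han']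
  have hanδ : 10 * a / n ≤ 1 / 1000000 := le_trans han'' (by linarith only [hδ1])
  have han0 : 0 ≤ 10 * a / n := by positivity
  have hMU0 : 0 ≤ MU := by
    have : 0 ≤ 1 - 10 * a / n := by linarith only [hanδ]
    positivity
  have hsum : (A₁ + A₂) * (n * ν) ^ 2 ≤ 150001 * M := by nlinarith only [hA1le, hA2le]
  have hMUle : MU ≤ δ / 60000 := by
    have h1 : MU ≤ 3 * (A₁ + A₂) := by
      have : A₁ + A₂ * (1 - 10 * a / n) ≤ A₁ + A₂ := by nlinarith only [han0, hA2pos]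
      have h0 : 0 ≤ A₁ + A₂ * (1 - 10 * a / n) := by
        have : 0 ≤ 1 - 10 * a / n := by linarith only [hanδ]
        positivity
      calc MU = A * (A₁ + A₂ * (1 - 10 * a / n)) := rfl
        _ ≤ 3 * (A₁ + A₂ * (1 - 10 * a / n)) := mul_le_mul_of_nonneg_right hA3 h0
        _ ≤ 3 * (A₁ + A₂) := by linarith only [this]
    -- 3·150001·M ≤ (δ/11900)(nν)² since (nν)² ≥ (10⁵(M+1)/δ)·(nν) ≥ …
    have h2 : 3 * 150001 * M * 60000 ≤ δ * (n * ν) ^ 2 := by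
      have : δ * (n * ν) ^ 2 = (δ * (n * ν)) * (n * ν) := by ring
      rw [this]
      nlinarith only [hK, hnν1, hM0]
    have h3 : 3 * (A₁ + A₂) ≤ δ / 60000 := by
      rw [le_div_iff₀ (by norm_num)]
      have hp : 0 < (n * ν) ^ 2 := by positivity
      have := hsum
      nlinarith only [hsum, h2, hp]
    exact h1.trans h3
  have hSY0 : 0 ≤ SY := by positivity
  have hSYle : SY ≤ 1 / 50 := by
    have h1 : SY ≤ 3 * (8 * (A₁ + A₂)) := by
      have : 2 * A₁ + 160 / 21 * A₂ ≤ 8 * (A₁ + A₂) := by nlinarith only [hA1pos, hA2pos]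
      calc SY = A * (2 * A₁ + 160 / 21 * A₂) := rfl
        _ ≤ 3 * (2 * A₁ + 160 / 21 * A₂) := mul_le_mul_of_nonneg_right hA3 (by positivity)
        _ ≤ 3 * (8 * (A₁ + A₂)) := by linarith only [this]
    have h2 : 24 * 150001 * M * 50 ≤ (n * ν) ^ 2 := by nlinarith only [hnν1, hM0, hK, hδ1]
    have hp : 0 < (n * ν) ^ 2 := by positivity
    have h3 : 24 * (A₁ + A₂) ≤ 1 / 50 := by
      rw [le_div_iff₀ (by norm_num)]
      nlinarith only [hsum, h2, hp]
    linarith only [h1, h3]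
  have hx0 : 0 ≤ x := mul_nonneg (by linarith only [hδ1]) hMU0
  have hxle : x ≤ MU := by
    have : (1 - δ / 50) ≤ 1 := by linarith only [hδ]
    exact mul_le_of_le_one_left hMU0 this
  have hx1 : x ≤ 1 / 100 := by linarith only [hxle, hMUle, hδ1]
  refine ⟨hMU0, hMUle, hSY0, hSYle, hx0, hx1, ?_, ?_, ?_, ?_, ?_⟩
  · -- END budget
    intro S hS0 hS
    have hS2 : S ^ 2 ≤ 4 * SY ^ 2 := by nlinarith only [hS0, hS]
    -- SY ≤ 16 MU (A₂ ≥ 4A₁ is not needed here: compare termwise with A ≥ 1… use SY ≤ 24(A₁+A₂), MU ≥ (A₁ + A₂/2))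
    have hMUlo : A * (A₁ + A₂ / 2) ≤ MU := by
      have : A₁ + A₂ / 2 ≤ A₁ + A₂ * (1 - 10 * a / n) := by nlinarith only [hanδ, hA2pos]
      exact mul_le_mul_of_nonneg_left this hA0.le
    have hSYMU : SY ≤ 16 * MU := by
      have : A * (2 * A₁ + 160 / 21 * A₂) ≤ 16 * (A * (A₁ + A₂ / 2)) := by
        nlinarith only [mul_pos hA0 hA1pos, mul_pos hA0 hA2pos]
      have eSY : SY = A * (2 * A₁ + 160 / 21 * A₂) := rfl
      linarith only [this, hMUlo, eSY]
    have h1 : x ^ 2 ≤ MU ^ 2 := pow_le_pow_left₀ hx0 hxle 2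
    have h2 : MU ^ 2 * 1025 ≤ δ / 50 * MU := by
      have := mul_le_mul_of_nonneg_left hMUle hMU0
      nlinarith only [this, hMU0, hδ]
    have h3 : SY ^ 2 ≤ 256 * MU ^ 2 := by nlinarith only [hSYMU, hSY0, hMU0]
    have ex : x = (1 - δ / 50) * MU := rfl
    nlinarith only [h1, h2, hS2, h3, ex, hMU0]
  · -- λ ≤ ν
    rw [div_le_iff₀ (by positivity)]
    nlinarith only [hx1, hM, hν]
  · -- a²/(10⁴n²ν) ≤ λ
    rw [div_le_div_iff₀ (by positivity) (by positivity)]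
    -- a² M 3720 ≤ 10⁴ n² ν · x ν ;  x ≥ (49/50)·A·(A₂/2)… use x ≥ (49/50) A (A₁ + A₂(1−10⁻⁶)) ≥ (49/50)(0.99) A A₂
    have hx_lo : 49 / 50 * (A * (99 / 100 * A₂)) ≤ x := by
      have h1 : 99 / 100 * A₂ ≤ A₁ + A₂ * (1 - 10 * a / n) := by nlinarith only [hanδ, hA2pos, hA1pos]
      have h2 : A * (99 / 100 * A₂) ≤ MU := mul_le_mul_of_nonneg_left h1 hA0.le
      have h3 : 49 / 50 ≤ 1 - δ / 50 := by linarith only [hδ1]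
      calc 49 / 50 * (A * (99 / 100 * A₂)) ≤ (1 - δ / 50) * (A * (99 / 100 * A₂)) :=
            mul_le_mul_of_nonneg_right h3 (by positivity)
        _ ≤ x := mul_le_mul_of_nonneg_left h2 (by linarith only [hδ1])
    have e : A * A₂ * (10000 * (n ^ 2 * ν) * ν) = 70000 * M * a ^ 2 / π ^ 2 := by
      simp only [A₂]; rw [hAa]; field_simp; ring
    have hp : 0 < 10000 * (n ^ 2 * ν) * ν := by positivity
    have h4 := mul_le_mul_of_nonneg_right hx_lo hp.le
    have h5 : 49 / 50 * (A * (99 / 100 * A₂)) * (10000 * (n ^ 2 * ν) * ν) =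
        49 / 50 * (99 / 100) * (70000 * M * a ^ 2 / π ^ 2) := by rw [← e]; ring
    rw [h5] at h4
    have h6 : a ^ 2 * (M * 3720) ≤ 49 / 50 * (99 / 100) * (70000 * M * a ^ 2 / π ^ 2) := by
      rw [mul_div_assoc', le_div_iff₀ (by positivity)]
      have : 0 ≤ M * a ^ 2 := by positivity
      nlinarith only [hπ16, this]
    nlinarith only [h4, h6]
  · -- the rate
    subst hcz
    -- target·(n²·3720M/ν)/2 = A₁' + (1−δ)A₂' with A₁' = 4π²3720M/n²·…; work with the inequality multiplied out
    have hx_lo : (1 - δ / 50) * (A * (A₁ + A₂ * (1 - δ / 1000000))) ≤ x := by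
      have h1 : A₁ + A₂ * (1 - δ / 1000000) ≤ A₁ + A₂ * (1 - 10 * a / n) := by nlinarith only [han'', hA2pos]
      exact mul_le_mul_of_nonneg_left (mul_le_mul_of_nonneg_left h1 hA0.le) (by linarith only [hδ1])
    have e : 8 * π ^ 2 * (1 + (1 - δ) * ((1 - 4 * (1 / 2 : ℝ) / 3) * (7 / (4960 * π ^ 4))) / ν ^ 2) * ν / n ^ 2 =
        2 * ((A₁ + (1 - δ) * A₂) * ν / (M * 3720)) := by
      simp only [A₁, A₂]; field_simp; ring
    rw [e]
    have hMp : 0 < M * 3720 := by positivity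
    rw [show 2 * (1 - 2 * (δ / 8)) * (x * ν / (M * 3720)) = 2 * (((1 - 2 * (δ / 8)) * x) * ν / (M * 3720)) by ring]
    refine mul_le_mul_of_nonneg_left ?_ (by norm_num)
    rw [div_le_div_iff_of_pos_right hMp]
    refine mul_le_mul_of_nonneg_right ?_ hν.le
    obtain ⟨c, hc⟩ : ∃ c : ℝ, c = (1 - 2 * (δ / 8)) * (1 - δ / 50) := ⟨_, rfl⟩
    have hc_lo : 1 - 27 / 100 * δ ≤ c := by rw [hc]; nlinarith only [hδ]
    have hc_hi : c ≤ 1 := by rw [hc]; nlinarith only [hδ, hδ1]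
    have hc0 : 0 ≤ c := by rw [hc]; exact mul_nonneg (by linarith only [hδ1]) (by linarith only [hδ1])
    have h2 : c * (A * (A₁ + A₂ * (1 - δ / 1000000))) ≤ (1 - 2 * (δ / 8)) * x := by
      have := mul_le_mul_of_nonneg_left hx_lo (by linarith only [hδ1] : (0:ℝ) ≤ 1 - 2 * (δ / 8))
      rw [hc]; linarith only [this]
    have hb : 0 ≤ A₁ + A₂ * (1 - δ / 1000000) := by
      have : 0 ≤ 1 - δ / 1000000 := by linarith only [hδ1]
      positivity
    have h4 : c * (1 * (A₁ + A₂ * (1 - δ / 1000000))) ≤ c * (A * (A₁ + A₂ * (1 - δ / 1000000))) :=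
      mul_le_mul_of_nonneg_left (mul_le_mul_of_nonneg_right hA1 hb) hc0
    have q1 : 0 ≤ (c - (1 - 27 / 100 * δ)) * (A₁ + A₂) := mul_nonneg (by linarith only [hc_lo]) (by positivity)
    have q2 : 0 ≤ (1 - c) * (δ * A₂) := mul_nonneg (by linarith only [hc_hi]) (by positivity)
    have p1 : 0 ≤ δ * (A₂ - 4 * A₁) := mul_nonneg hδ.le (by linarith only [hA21])
    have h3 : A₁ + (1 - δ) * A₂ ≤ c * (1 * (A₁ + A₂ * (1 - δ / 1000000))) := by
      nlinarith only [q1, q2, p1, hδ, hA1pos, hA2pos, hc0]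
    linarith only [h2, h3, h4]
  · -- the prefactor
    have e : 2 * (1 - 2 * (δ / 8)) * (x * ν / (M * 3720)) * (M * 3720 / ν) = 2 * (1 - 2 * (δ / 8)) * x := by
      field_simp
    rw [e]
    have h1 : 2 * (1 - 2 * (δ / 8)) * x ≤ 1 := by nlinarith only [hx1, hx0, hδ, hδ1]
    have h2 : Real.exp (2 * (1 - 2 * (δ / 8)) * x) ≤ 3 :=
      le_trans (Real.exp_le_exp.2 h1) (le_of_lt (lt_trans Real.exp_one_lt_d9 (by norm_num)))
    rw [div_div, le_div_iff₀ (by positivity)]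
    have h3 : 200000 / δ * Real.exp (2 * (1 - 2 * (δ / 8)) * x) * (δ * ν) =
        200000 * ν * Real.exp (2 * (1 - 2 * (δ / 8)) * x) := by field_simp
    rw [h3]
    have hν1' : ν ≤ 1 := by linarith only [hν1]
    nlinarith only [h2, hν, hν1', hM, Real.exp_pos (2 * (1 - 2 * (δ / 8)) * x)]

end Summit.AnomalousDissipation.AnomalousDissipation.Theorems.SolenoidalFractalHomogenisation.RealisedQuasiStaticCellLaw

end
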